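import Summits.ValiantsHypothesis.ValiantsHypothesis.Theorems.NNDivisionHard.Negative.RealLambdaPencil

/-!
# Real-λ blindness of the located permutahedron pencil, part 3 (§4): ★★ THEOREM T2 — the degree-`D` conjunction certificate FAILS below `(m − D)/m²` (`λ_D ≥ 1/(4D)`)

PORT NOTE (staged by the AUTHOR val-idea-39 g5 for the Negative-lane port pool; critic of record val-idea-crit-9 g3, V#111c booked rev 2 «KERNEL VERIFIED:
S2 ANSWERED, no λ_c»): texts VERBATIM BY NAME from the crux workfile `Cruxes/NNDivisionHard/RealLambda39.lean` rev 4 @311ce0a993de (sha16 ce0b080758a4c26c,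
farm rc 0 / 0 sorries / 0 warnings), memo `Cruxes/NNDivisionHard/RealLambda39.md` rev 2 @19a32fa804d9.  Deltas vs the workfile: namespace
`…Theorems.NNDivisionHardNegative.RealLambda` (sibling of `…WeakReliefBlind`), split into three parts (§1–§2 / §3+§5 / §4), this header.  CENSUS / CALIBRATION
theorems about ONE certificate family (conjunctions of boundedly many literals on a size class); no item closes; VP ≠ VNP is NOT proved; the crux
`NNDivisionHard` (stmt-ValiantsHypothesis-21181) stays OPEN; nothing here bears on its status.

The swap functional `swapFn D P x y f = (D − m)·f(P) + Σ_{j<m} f(P − x_j + y_j)` (`D·μ[f]` for the signed measure `μ = (1 − m/D)·δ_P + (1/D)·Σ_j δ_{a_j}`)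
is nonnegative on every conjunction of `≤ D` literals as soon as `x`, `y` are injective (`swapFn_cj_nonneg`: a conjunction true at `P` fails at `a_j` only
if `x_j ∈ S` or `y_j ∈ T` — at most `|S|+|T| ≤ D` indices), hence on `cone_D` (`swapFn_nonneg_of_inCone`).  With the closed form
`inv_closed : inv(a;π) = Σ_{l∈a} π(l) − (|a|²−|a|)/2`, insiders `x_j` at positions `k−1−j`, outsiders `y_j` at positions `k+j` and the column
`cutCol π k m = π⁻¹{k,…,k+m−1}`: `μ[(1−|a∩b|)² + λ·inv] ≤ (1 − m/D) + λ·m²/D`, so the `k`-slice of that column is NOT in `cone_D` when `λ·m² < m − D`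
(`slice_cone_lower`); `m = 2D`: `λ_D ≥ 1/(4D)` (`slice_cone_lower_quarter`); the upper half in the same shape is `slice_cone_upper` (degree `2T` succeeds for
every column when `λT ≥ 2`, part 2).  In the kernel: the least certificate degree of this family satisfies `1/(4λ) < D(λ) ≤ 2⌈2/λ⌉`.
-/

-- the mandated summit-side namespace repeats a component by design (single-problem summit)
set_option linter.dupNamespace false

namespace Summit.ValiantsHypothesis.Theorems.NNDivisionHardNegative.RealLambda

open Finset
open Summit.ValiantsHypothesis.Theorems.NNDivisionHardNegative.WeakReliefBlind (posLT inv card_posLT)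

noncomputable section

variable {n : ℕ}

/-! ## §4 The lower half (memo T2): the swap functional — degree `D` FAILS when `λ·m² < m − D`

The signed measure `μ = (1 − m/D)·δ_P + (1/D)·Σ_{j<m} δ_{a_j}` (`a_j = P − x_j + y_j`, insiders `x_j` at positions `k−1−j`, outsiders `y_j` at
positions `k+j`) is nonnegative on every conjunction of `≤ D` literals (a conjunction true at `P` fails at `a_j` only if it mentions `x_j`
positively or `y_j` negatively: at most `|S|+|T| ≤ D` indices `j`), while on the column `b =` the `m` outsider positions nearest the cut
`μ[(1−|a∩b|)² + λ·inv] ≤ (1 − m/D) + λ·m²/D`.  Hence the `k`-slice restriction of that column is NOT in `cone_D` when `λ·m² < m − D`;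
with `m = 2D`: `λ_D ≥ 1/(4D)`.  Together with §3 (`slice_cone_upper`): `1/(4λ) < D(λ) ≤ 2⌈2/λ⌉`. -/

section Lower
variable {m : ℕ} (D : ℕ) (P : Finset (Fin n)) (x y : Fin m → Fin n)

/-- swap row `a_j = P − x_j + y_j` -/
def swapRow (j : Fin m) : Finset (Fin n) := insert (y j) (P.erase (x j))

/-- the swap functional `D·μ[f] = (D − m)·f(P) + Σ_j f(a_j)` -/
def swapFn (f : Finset (Fin n) → ℝ) : ℝ := ((D : ℝ) - m) * f P + ∑ j, f (swapRow P x y j)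

/-- Port helper `swapFn_add` (statement and proof verbatim from the crux workfile; see the file header). -/
theorem swapFn_add (f g : Finset (Fin n) → ℝ) :
    swapFn D P x y (fun a => f a + g a) = swapFn D P x y f + swapFn D P x y g := by
  unfold swapFn; rw [Finset.sum_add_distrib]; ring

/-- Port helper `swapFn_smul` (statement and proof verbatim from the crux workfile; see the file header). -/
theorem swapFn_smul (w : ℝ) (f : Finset (Fin n) → ℝ) :
    swapFn D P x y (fun a => w * f a) = w * swapFn D P x y f := by
  unfold swapFn; rw [mul_add, Finset.mul_sum]; ring

variable {D P x y}

/-- `μ ≥ 0` on conjunctions of `≤ D` literals (only the injectivity of `x`, `y` is used: a conjunction true at `P` fails at `a_j` only if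
`x_j ∈ S` or `y_j ∈ T`) -/
theorem swapFn_cj_nonneg (hxi : Function.Injective x) (hyi : Function.Injective y)
    (S T : Finset (Fin n)) (hST : S.card + T.card ≤ D) :
    0 ≤ swapFn D P x y (cj S T) := by
  classical
  unfold swapFn
  have hsum0 : 0 ≤ ∑ j, cj S T (swapRow P x y j) := Finset.sum_nonneg fun j _ => cj_nonneg _ _ _
  by_cases hP : S ⊆ P ∧ Disjoint T P
  · have hcP : cj S T P = 1 := by simp [cj, hP]
    rw [hcP, mul_one]
    have hpt : ∀ j, (1 : ℝ) - (if x j ∈ S then 1 else 0) - (if y j ∈ T then 1 else 0) ≤ cj S T (swapRow P x y j) := by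
      intro j
      have h0 := cj_nonneg S T (swapRow P x y j)
      by_cases h1 : x j ∈ S
      · simp only [h1, if_true]
        split_ifs <;> linarith
      · by_cases h2 : y j ∈ T
        · simp only [h1, h2, if_true, if_false]
          linarith
        · have : cj S T (swapRow P x y j) = 1 := by
            unfold cj swapRow
            rw [if_pos]
            constructor
            · intro s hs
              have hsP : s ∈ P := hP.1 hs
              have hsx : s ≠ x j := fun e => h1 (e ▸ hs)
              exact Finset.mem_insert_of_mem (Finset.mem_erase.mpr ⟨hsx, hsP⟩)
            · rw [Finset.disjoint_insert_right]
              exact ⟨h2, hP.2.mono_right (Finset.erase_subset _ _)⟩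
          rw [this]
          simp [h1, h2]
    have hcx : ((Finset.univ.filter fun j => x j ∈ S).card : ℝ) ≤ S.card := by
      exact_mod_cast Finset.card_le_card_of_injOn x (fun j hj => by
        have := (Finset.mem_filter.mp (Finset.mem_coe.mp hj)).2; exact this) (fun j₁ _ j₂ _ e => hxi e)
    have hcy : ((Finset.univ.filter fun j => y j ∈ T).card : ℝ) ≤ T.card := by
      exact_mod_cast Finset.card_le_card_of_injOn y (fun j hj => by
        have := (Finset.mem_filter.mp (Finset.mem_coe.mp hj)).2; exact this) (fun j₁ _ j₂ _ e => hyi e)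
    have hsum : ∑ j : Fin m, ((1 : ℝ) - (if x j ∈ S then 1 else 0) - (if y j ∈ T then 1 else 0))
        = (m : ℝ) - (Finset.univ.filter fun j => x j ∈ S).card - (Finset.univ.filter fun j => y j ∈ T).card := by
      rw [Finset.sum_sub_distrib, Finset.sum_sub_distrib, Finset.sum_const, Finset.card_univ, Fintype.card_fin,
        nsmul_eq_mul, mul_one, Finset.sum_boole, Finset.sum_boole]
    have hle := Finset.sum_le_sum fun j (_ : j ∈ (Finset.univ : Finset (Fin m))) => hpt j
    rw [hsum] at hle
    have hD : ((S.card : ℝ)) + T.card ≤ D := by exact_mod_cast hST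
    linarith
  · have hcP : cj S T P = 0 := by simp [cj, hP]
    rw [hcP, mul_zero, zero_add]
    exact hsum0

/-- `μ ≥ 0` on the whole cone `cone_D` -/
theorem swapFn_nonneg_of_inCone (hxi : Function.Injective x) (hyi : Function.Injective y)
    {g : Finset (Fin n) → ℝ} (hg : InCone D g) : 0 ≤ swapFn D P x y g := by
  induction hg with
  | @atom w S T hw hST =>
    rw [swapFn_smul]
    exact mul_nonneg hw (swapFn_cj_nonneg hxi hyi S T hST)
  | add _ _ ihf ihg =>
    rw [swapFn_add]
    exact add_nonneg ihf ihg

/-- Port helper `swapRow_card` (statement and proof verbatim from the crux workfile; see the file header). -/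
theorem swapRow_card (hx : ∀ j, x j ∈ P) (hy : ∀ j, y j ∉ P) (j : Fin m) : (swapRow P x y j).card = P.card := by
  unfold swapRow
  rw [Finset.card_insert_of_notMem (fun h => hy j (Finset.mem_of_mem_erase h)), Finset.card_erase_of_mem (hx j)]
  have : 0 < P.card := Finset.card_pos.mpr ⟨x j, hx j⟩
  omega

/-- Port helper `sum_X_mul` (statement and proof verbatim from the crux workfile; see the file header). -/
theorem sum_X_mul (a : Finset (Fin n)) (f : Fin n → ℝ) : ∑ l, X a l * f l = ∑ l ∈ a, f l := by
  classical
  unfold X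
  simp only [ite_mul, one_mul, zero_mul]
  rw [Finset.sum_ite_mem, Finset.univ_inter]

/-- Port helper `swapRow_sum` (statement and proof verbatim from the crux workfile; see the file header). -/
theorem swapRow_sum (hx : ∀ j, x j ∈ P) (hy : ∀ j, y j ∉ P) (j : Fin m) (f : Fin n → ℝ) :
    ∑ l ∈ swapRow P x y j, f l = ∑ l ∈ P, f l - f (x j) + f (y j) := by
  unfold swapRow
  rw [Finset.sum_insert (fun h => hy j (Finset.mem_of_mem_erase h)), ← Finset.add_sum_erase P f (hx j)]
  ring

end Lower

section ClosedForm
variable (π : Equiv.Perm (Fin n))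

/-- Port helper `inv_nonneg_real` (statement and proof verbatim from the crux workfile; see the file header). -/
theorem inv_nonneg_real (a : Finset (Fin n)) : 0 ≤ (inv a π : ℝ) := by
  rw [inv_cast]
  exact Finset.sum_nonneg fun l _ => Finset.sum_nonneg fun l' _ =>
    mul_nonneg (mul_nonneg (X_nonneg _ _) (by linarith [X_le_one a l'])) (by unfold χ; split_ifs <;> norm_num)

/-- CLOSED FORM: `inv(a;π) = Σ_{l ∈ a} π(l) − (|a|² − |a|)/2` (positions sum minus the internal pairs). -/
theorem inv_closed (a : Finset (Fin n)) :
    (inv a π : ℝ) = ∑ l, X a l * ((π l : ℕ) : ℝ) - ((a.card : ℝ) ^ 2 - a.card) / 2 := by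
  classical
  have hS : ∑ l, ∑ l', X a l * X a l' * χ π l l' = ∑ l, ∑ l', X a l * X a l' * χ π l' l := by
    rw [Finset.sum_comm]
    exact Finset.sum_congr rfl fun l _ => Finset.sum_congr rfl fun l' _ => by ring
  have h2S : 2 * ∑ l, ∑ l', X a l * X a l' * χ π l l' = (a.card : ℝ) ^ 2 - a.card := by
    have e : 2 * ∑ l, ∑ l', X a l * X a l' * χ π l l' =
        ∑ l, ∑ l', (X a l * X a l' - X a l * X a l' * (if l = l' then (1:ℝ) else 0)) := by
      rw [two_mul]
      nth_rewrite 2 [hS]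
      rw [← Finset.sum_add_distrib]
      refine Finset.sum_congr rfl fun l _ => ?_
      rw [← Finset.sum_add_distrib]
      refine Finset.sum_congr rfl fun l' _ => ?_
      have h := χ_trich π l l'
      linear_combination (X a l * X a l') * h
    rw [e]
    have e2 : ∀ l, ∑ l', (X a l * X a l' - X a l * X a l' * (if l = l' then (1:ℝ) else 0)) =
        X a l * ∑ l', X a l' - X a l := by
      intro l
      rw [Finset.sum_sub_distrib, Finset.mul_sum]
      congr 1
      simp only [mul_ite, mul_one, mul_zero, Finset.sum_ite_eq, Finset.mem_univ, if_true]
      exact X_mul_self a l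
    rw [Finset.sum_congr rfl fun l _ => e2 l, Finset.sum_sub_distrib, ← Finset.sum_mul, sum_X_univ]
    ring
  have e3 : ∀ l, ∑ l', X a l * (1 - X a l') * χ π l l' =
      X a l * ((π l : ℕ) : ℝ) - ∑ l', X a l * X a l' * χ π l l' := by
    intro l
    rw [← sum_χ π l, Finset.mul_sum, ← Finset.sum_sub_distrib]
    exact Finset.sum_congr rfl fun l' _ => by ring
  rw [inv_cast, Finset.sum_congr rfl fun l _ => e3 l, Finset.sum_sub_distrib]
  linarith [h2S]

/-- Port helper `gauss_real` (statement and proof verbatim from the crux workfile; see the file header). -/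
theorem gauss_real (k : ℕ) : ∑ i ∈ Finset.range k, (i : ℝ) = ((k : ℝ) ^ 2 - k) / 2 := by
  induction k with
  | zero => simp
  | succ k ih => rw [Finset.sum_range_succ, ih]; push_cast; ring

/-- Port helper `odd_sum_fin` (statement and proof verbatim from the crux workfile; see the file header). -/
theorem odd_sum_fin (m : ℕ) : ∑ j : Fin m, (2 * ((j : ℕ) : ℝ) + 1) = (m : ℝ) ^ 2 := by
  have h := Fin.sum_univ_eq_sum_range (fun i : ℕ => 2 * (i : ℝ) + 1) m
  rw [h]
  clear h
  -- `Σ_{i<m} (2i+1) = m²` inlined (the stand-alone lemma exists in the tree as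
  -- `Literature.Probability.Percolation.sum_range_two_mul_add_one`; not imported to keep the import surface local)
  induction m with
  | zero => simp
  | succ m ih => rw [Finset.sum_range_succ, ih]; push_cast; ring

/-- `Σ_{l ∈ P} π(l) = (k² − k)/2` for `P = posLT π k` (the positions `0, …, k−1`) -/
theorem sum_pos_posLT {k : ℕ} (hk : k ≤ n) : ∑ l ∈ posLT π k, ((π l : ℕ) : ℝ) = ((k : ℝ) ^ 2 - k) / 2 := by
  classical
  rw [show posLT π k = Finset.univ.filter (fun l : Fin n => (π l : ℕ) < k) from rfl, Finset.sum_filter]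
  have h1 := Equiv.sum_comp π (fun i : Fin n => if (i : ℕ) < k then ((i : ℕ) : ℝ) else 0)
  rw [h1]
  have h2 := Fin.sum_univ_eq_sum_range (fun i : ℕ => if i < k then (i : ℝ) else 0) n
  rw [h2, ← Finset.sum_filter]
  have h3 : (Finset.range n).filter (fun i => i < k) = Finset.range k := by
    ext i; simp only [Finset.mem_filter, Finset.mem_range]; omega
  rw [h3, gauss_real]

end ClosedForm

section T2
variable (π : Equiv.Perm (Fin n)) (k m : ℕ)

/-- the column of T2: the `m` outsider positions nearest the cut, `b = π⁻¹{k, …, k+m−1}` -/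
def cutCol : Finset (Fin n) := Finset.univ.filter (fun u => k ≤ (π u : ℕ) ∧ (π u : ℕ) < k + m)

/-- ★★ **THEOREM T2 (kernel): the degree-`D` certificate FAILS below `(m − D)/m²`.**  If the `k`-slice restriction of the column
`(1 − |a ∩ b|)² + λ·inv(a;π)`, `b = cutCol π k m` (`m ≤ k`, `k + m ≤ n`), agrees with some member of `cone_D`, then `m − D ≤ λ·m²`. -/
theorem slice_cone_lower (D : ℕ) (lam : ℝ) (hlam : 0 ≤ lam) (hmk : m ≤ k) (hkm : k + m ≤ n)
    (h : ∃ g, InCone D g ∧ ∀ a : Finset (Fin n), a.card = k →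
      ((1 : ℝ) - ((a ∩ cutCol π k m).card : ℝ)) ^ 2 + lam * (inv a π : ℝ) = g a) :
    ((m : ℝ) - D) ≤ lam * (m : ℝ) ^ 2 := by
  classical
  by_cases hDm : m ≤ D
  · have h1 : (m : ℝ) ≤ D := by exact_mod_cast hDm
    have h2 : 0 ≤ lam * (m : ℝ) ^ 2 := by positivity
    linarith
  push Not at hDm
  obtain ⟨g, hg, hga⟩ := h
  have hPk : (posLT π k).card = k := card_posLT π (by omega)
  have hmemP : ∀ u, u ∈ posLT π k ↔ (π u : ℕ) < k := fun u => by simp [posLT]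
  have hmemC : ∀ u, u ∈ cutCol π k m ↔ k ≤ (π u : ℕ) ∧ (π u : ℕ) < k + m := fun u => by simp [cutCol]
  let x : Fin m → Fin n := fun j => π.symm ⟨k - 1 - (j : ℕ), by omega⟩
  let y : Fin m → Fin n := fun j => π.symm ⟨k + (j : ℕ), by omega⟩
  have hpx : ∀ j, ((π (x j) : ℕ)) = k - 1 - (j : ℕ) := fun j => by simp [x]
  have hpy : ∀ j, ((π (y j) : ℕ)) = k + (j : ℕ) := fun j => by simp [y]
  have hx : ∀ j, x j ∈ posLT π k := fun j => (hmemP _).mpr (by rw [hpx]; omega)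
  have hy : ∀ j, y j ∉ posLT π k := fun j h => by have := (hmemP _).mp h; rw [hpy] at this; omega
  have hxi : Function.Injective x := by
    intro j₁ j₂ e
    have h' := congrArg (fun u => (π u : ℕ)) e
    simp only [hpx] at h'
    exact Fin.ext (by omega)
  have hyi : Function.Injective y := by
    intro j₁ j₂ e
    have h' := congrArg (fun u => (π u : ℕ)) e
    simp only [hpy] at h'
    exact Fin.ext (by omega)
  have hμ := swapFn_nonneg_of_inCone (D := D) (P := posLT π k) hxi hyi hg
  -- evaluation at P
  have hPc : posLT π k ∩ cutCol π k m = ∅ := by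
    ext u
    simp only [Finset.mem_inter]
    constructor
    · rintro ⟨hu1, hu2⟩
      have := (hmemP u).mp hu1
      have := ((hmemC u).mp hu2).1
      omega
    · intro hu; simp at hu
  have hgP : g (posLT π k) = 1 + lam * (inv (posLT π k) π : ℝ) := by
    rw [← hga _ hPk, hPc]; simp
  -- evaluation at the swap rows
  have hcardj : ∀ j, (swapRow (posLT π k) x y j).card = k := fun j => by rw [swapRow_card hx hy, hPk]
  have hjc : ∀ j, swapRow (posLT π k) x y j ∩ cutCol π k m = {y j} := by
    intro j; ext u
    simp only [swapRow, Finset.mem_inter, Finset.mem_insert, Finset.mem_erase, Finset.mem_singleton, hmemC]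
    constructor
    · rintro ⟨h1 | ⟨_, huP⟩, h2, _⟩
      · exact h1
      · have := (hmemP u).mp huP; omega
    · intro e; subst e; exact ⟨Or.inl rfl, by rw [hpy]; omega, by rw [hpy]; omega⟩
  have hpxR : ∀ j, ((π (x j) : ℕ) : ℝ) = (k : ℝ) - 1 - ((j : ℕ) : ℝ) := by
    intro j
    rw [hpx, show k - 1 - (j : ℕ) = k - ((j : ℕ) + 1) by omega, Nat.cast_sub (by omega)]
    push_cast; ring
  have hpyR : ∀ j, ((π (y j) : ℕ) : ℝ) = (k : ℝ) + ((j : ℕ) : ℝ) := by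
    intro j; rw [hpy]; push_cast; ring
  have hinvj : ∀ j, (inv (swapRow (posLT π k) x y j) π : ℝ) = 2 * ((j : ℕ) : ℝ) + 1 := by
    intro j
    rw [inv_closed, sum_X_mul, swapRow_sum hx hy, hcardj, sum_pos_posLT π (by omega), hpxR, hpyR]
    ring
  have hgj : ∀ j, g (swapRow (posLT π k) x y j) = lam * (2 * ((j : ℕ) : ℝ) + 1) := by
    intro j
    rw [← hga _ (hcardj j), hjc, hinvj]
    simp
  -- the functional inequality
  unfold swapFn at hμ
  rw [hgP, Finset.sum_congr rfl fun j _ => hgj j, ← Finset.mul_sum, odd_sum_fin] at hμ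
  have hneg : ((D : ℝ) - m) ≤ 0 := by
    have : (D : ℝ) < m := by exact_mod_cast hDm
    linarith
  have hi : 0 ≤ lam * (inv (posLT π k) π : ℝ) := mul_nonneg hlam (inv_nonneg_real π _)
  have : ((D : ℝ) - m) * (1 + lam * (inv (posLT π k) π : ℝ)) ≤ (D : ℝ) - m := by nlinarith
  linarith

/-- COROLLARY `λ_D ≥ 1/(4D)` (take `m = 2D`; needs `2D ≤ k`, `k + 2D ≤ n`). -/
theorem slice_cone_lower_quarter (D : ℕ) (lam : ℝ) (hlam : 0 ≤ lam) (hD : 1 ≤ D) (h2D : 2 * D ≤ k)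
    (hn : k + 2 * D ≤ n)
    (h : ∃ g, InCone D g ∧ ∀ a : Finset (Fin n), a.card = k →
      ((1 : ℝ) - ((a ∩ cutCol π k (2 * D)).card : ℝ)) ^ 2 + lam * (inv a π : ℝ) = g a) :
    1 / (4 * (D : ℝ)) ≤ lam := by
  have h1 := slice_cone_lower π k (2 * D) D lam hlam h2D hn h
  push_cast at h1
  have hD' : (0 : ℝ) < D := by exact_mod_cast hD
  rw [div_le_iff₀ (by positivity)]
  by_contra hc
  push Not at hc
  nlinarith

/-- the UPPER half in the same shape (§3): degree `2T` SUCCEEDS for every column as soon as `λT ≥ 2`. -/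
theorem slice_cone_upper (lam : ℝ) (hlam : 0 < lam) (T : ℕ) (hT : 2 ≤ lam * T) (b : Finset (Fin n)) :
    ∃ g, InCone (2 * T) g ∧ ∀ a : Finset (Fin n), a.card = k →
      ((1 : ℝ) - ((a ∩ b).card : ℝ)) ^ 2 + lam * (inv a π : ℝ) = g a :=
  ⟨_, col_inCone π k b hlam hT, fun _ hk => col_eq lam π k b hk⟩

end T2

end

end Summit.ValiantsHypothesis.Theorems.NNDivisionHardNegative.RealLambda
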